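import Mathlib
import HarnessLib
import Summits.ResolutionOfSingularities.ResolutionOfSingularities.Theorems.WildQuotientsWildQuotientResolutionS1aTameRootChartAway
import Summits.ResolutionOfSingularities.ResolutionOfSingularities.Theorems.WildQuotientsWildQuotientResolutionS1aOneShotKillLocal
import Summits.ResolutionOfSingularities.ResolutionOfSingularities.Theorems.WildQuotientsWildQuotientResolutionS1aProducerStep

/-!
# S1a — NODES LOCALISE: a tame node `(B, 𝒜, σ)` localised at a degree-`0` `σ`-invariant element `h` is a tame node
# `(B[h⁻¹], locPiece, σ_h)`; killed nodes stay killed; the degree-`0` part is `B₀[h⁻¹]` (ring level of the chart-shrink lemmas)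

[OURS · L1 W4.5c · lead-1 g8; infrastructure for `PrincipalCentreChartShrink` (support form) / `KillableAtOfIdle` / (A3), SIG
`L/w45c/W45cKillOrAux.lean` v3, STRATEGY-DESIGN v3.2 §3] — NOT statements of the manuscript; counted 0; AI-level work, weaker than expert
review. Crux stmt-ResolutionOfSingularities-17941, line `s1a-logminvertex` v6. Pure commutative algebra, route-independent.

For a graded ring `(B, 𝒜)` (`𝒜 : ι → AddSubgroup B`), a ring automorphism `σ` and `h ∈ 𝒜 0` with `σ h = h`:
* `sigmaAway σ hσh : B[h⁻¹] ≃+* B[h⁻¹]` — the induced automorphism (`IsLocalization.ringEquivOfRingEquiv`); pins `sigmaAway_algebraMap`,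
  `sigmaAway_invSelf`, `sigmaAway_mk`; `sigmaAway_iterate_eq_self` (`σ^[p] = id ⇒ σ_h^[p] = id`); `sigmaAway_mem_locPiece` (graded for
  `GradedLocalization.locPiece 𝒜 hh`, p576317); `augmentationIdeal_sigmaAway` (`= I_σ · B[h⁻¹]`, from (e1) p590971) and
  `isPrincipal_augmentationIdeal_sigmaAway` (KILLED NODES STAY KILLED);
* **`isTameNode_away`** — `IsTameNode p B 𝒜 σ → IsTameNode p B[h⁻¹] (locPiece 𝒜 hh) (sigmaAway σ hσh)` (Noetherian, regular by
  `isRegularRing_of_isLocalization`, (T1) same units, (T2) generators `t ∪ {h⁻¹}`, graded, order `p`);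
* **`awayZeroEquiv 𝒜 e a : A[a⁻¹] ≃+* (B[h⁻¹])₀`** for a ring `A` with `e : A ≃+* 𝒜 0` and `h = e a` (the degree-`0` part of the localised
  grading IS the localised degree-`0` part), with the pin `awayZeroEquiv_mk` (`x/aⁿ ↦ e x / hⁿ`) and `awayZeroEquiv_algebraMap`;
* `coe_awayZeroEquiv_intertwine` — if `act : A →+* A` satisfies `e (act t) = σ (e t)` and `act a = a`, then the induced endomorphism of
  `A[a⁻¹]` is intertwined with `σ_h` by `awayZeroEquiv` (stated for any ring hom `act' : A[a⁻¹] → A[a⁻¹]` extending `act`).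
-/

set_option linter.dupNamespace false

noncomputable section

open DirectSum Literature.AlgebraicGeometry.Resolution
open Summit.ResolutionOfSingularities.ResolutionOfSingularities.Theorems.WildQuotientResolution.S1.GradedLocalization
open Summit.ResolutionOfSingularities.ResolutionOfSingularities.Theorems.WildQuotientResolution.S1.ProducerStep

namespace Summit.ResolutionOfSingularities.ResolutionOfSingularities.Theorems.WildQuotientResolution.S1.NodeAway

universe u v

/-! ## The induced automorphism of `B[h⁻¹]` -/

section Sigma

variable {B : Type u} [CommRing B] (σ : B ≃+* B) {h : B} (hσh : σ h = h)

include hσh in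
/-- `σ` maps the powers of an invariant element onto themselves. -/
theorem map_powers_eq : (Submonoid.powers h).map σ.toMonoidHom = Submonoid.powers h := by
  rw [Submonoid.map_powers]
  exact congrArg Submonoid.powers hσh

/-- **The automorphism `σ_h` of `B[h⁻¹]` induced by `σ`** (`h` invariant). [OURS · L1 W4.5c] -/
def sigmaAway : Localization.Away h ≃+* Localization.Away h :=
  IsLocalization.ringEquivOfRingEquiv (Localization.Away h) (Localization.Away h) σ (map_powers_eq σ hσh)

/-- Pin: `σ_h (x/1) = σ x / 1`. -/
@[simp] theorem sigmaAway_algebraMap (x : B) :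
    sigmaAway σ hσh (algebraMap B (Localization.Away h) x) = algebraMap B (Localization.Away h) (σ x) :=
  IsLocalization.ringEquivOfRingEquiv_eq _ x

/-- Pin: `σ_h (h⁻¹) = h⁻¹`. -/
@[simp] theorem sigmaAway_invSelf : sigmaAway σ hσh (IsLocalization.Away.invSelf h) = IsLocalization.Away.invSelf h := by
  have h1 : algebraMap B (Localization.Away h) h * IsLocalization.Away.invSelf h = 1 := IsLocalization.Away.mul_invSelf h
  have h2 : algebraMap B (Localization.Away h) h * sigmaAway σ hσh (IsLocalization.Away.invSelf h) = 1 := by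
    have := congrArg (sigmaAway σ hσh) h1
    rwa [map_mul, map_one, sigmaAway_algebraMap, hσh] at this
  exact (IsLocalization.Away.algebraMap_isUnit h).mul_left_cancel (h2.trans h1.symm)

/-- Pin: `σ_h (x / hᵐ) = σ x / hᵐ`. -/
theorem sigmaAway_mk (x : B) (m : ℕ) :
    sigmaAway σ hσh (algebraMap B (Localization.Away h) x * IsLocalization.Away.invSelf h ^ m) =
      algebraMap B (Localization.Away h) (σ x) * IsLocalization.Away.invSelf h ^ m := by
  rw [map_mul, map_pow, sigmaAway_algebraMap, sigmaAway_invSelf]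

/-- `σ^[p] = id ⇒ σ_h^[p] = id`. -/
theorem sigmaAway_iterate_eq_self {p : ℕ} (hσp : ∀ x : B, σ^[p] x = x) (y : Localization.Away h) :
    (sigmaAway σ hσh)^[p] y = y :=
  OneShotKill.ringEquivOfRingEquiv_iterate_eq_self σ (map_powers_eq σ hσh) hσp y

/-- **`I_{σ_h} = I_σ · B[h⁻¹]`** (augmentation ideals commute with localisation, (e1) p590971). -/
theorem augmentationIdeal_sigmaAway :
    augmentationIdeal (sigmaAway σ hσh) = (augmentationIdeal σ).map (algebraMap B (Localization.Away h)) :=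
  OneShotKill.augmentationIdeal_ringEquivOfRingEquiv σ (map_powers_eq σ hσh)

/-- **Killed nodes stay killed**: a principal augmentation ideal stays principal. [OURS · L1 W4.5c] -/
theorem isPrincipal_augmentationIdeal_sigmaAway (hI : (augmentationIdeal σ).IsPrincipal) :
    (augmentationIdeal (sigmaAway σ hσh)).IsPrincipal := by
  obtain ⟨ν, hν⟩ := hI
  rw [augmentationIdeal_sigmaAway, hν]
  refine ⟨⟨algebraMap B (Localization.Away h) ν, ?_⟩⟩
  change Ideal.map _ (Ideal.span {ν}) = Ideal.span {algebraMap B (Localization.Away h) ν}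
  rw [Ideal.map_span, Set.image_singleton]

variable {ι : Type v} [AddCommGroup ι] [DecidableEq ι] (𝒜 : ι → AddSubgroup B) [GradedRing 𝒜] (hh : h ∈ 𝒜 0)

/-- `σ_h` is graded for the localised grading (`σ` graded). -/
theorem sigmaAway_mem_locPiece (hσ𝒜 : ∀ (d : ι) (b : B), b ∈ 𝒜 d → σ b ∈ 𝒜 d) {e : ι} {y : Localization.Away h}
    (hy : y ∈ locPiece 𝒜 hh e) : sigmaAway σ hσh y ∈ locPiece 𝒜 hh e := by
  obtain ⟨m, x, hx, rfl⟩ := (mem_locPiece_zero_iff 𝒜 hh).mp hy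
  rw [sigmaAway_mk]
  exact (mem_locPiece_zero_iff 𝒜 hh).mpr ⟨m, σ x, hσ𝒜 e x hx, rfl⟩

/-- **TAME NODES LOCALISE at degree-`0` invariant elements.** [OURS · L1 W4.5c] -/
theorem isTameNode_away {p : ℕ} (hnode : IsTameNode p B 𝒜 σ) :
    @IsTameNode p ι _ _ (Localization.Away h) _ (locPiece 𝒜 hh) (locGradedRing 𝒜 hh) (sigmaAway σ hσh) := by
  classical
  obtain ⟨hN, hR, ⟨s, hs, hfin⟩, ⟨t, ht⟩, hσ𝒜, hσp⟩ := hnode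
  haveI := hN
  haveI := hR
  letI := locGradedRing 𝒜 hh
  refine ⟨IsLocalization.isNoetherianRing (Submonoid.powers h) _ hN, isRegularRing_of_isLocalization (Submonoid.powers h) _,
    ?_, ?_, fun e y hy => sigmaAway_mem_locPiece σ hσh 𝒜 hh hσ𝒜 hy, sigmaAway_iterate_eq_self σ hσh hσp⟩
  · -- (T1): the same units
    refine ⟨s, fun d hd => ?_, hfin⟩
    obtain ⟨u, hu, hud⟩ := hs d hd
    exact ⟨algebraMap B _ u, hu.map _, algebraMap_mem_locPiece 𝒜 hh hud⟩
  · -- (T2): the images of `t`, and `h⁻¹` is of degree `0`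
    refine ⟨t.image (algebraMap B (Localization.Away h)), ?_⟩
    rw [eq_top_iff]
    rintro y -
    obtain ⟨x, n, rfl⟩ := exists_eq_algebraMap_mul_invSelf_pow (h := h) y
    have hinv : IsLocalization.Away.invSelf h ∈ Subring.closure
        (((locPiece 𝒜 hh 0 : AddSubgroup (Localization.Away h)) : Set (Localization.Away h)) ∪
          ↑(t.image (algebraMap B (Localization.Away h)))) :=
      Subring.subset_closure (Or.inl (invSelf_mem_locPiece_zero 𝒜 hh))
    have hx : x ∈ Subring.closure (((𝒜 0 : AddSubgroup B) : Set B) ∪ ↑t) := by rw [ht]; trivial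
    have hmap : (Subring.closure (((𝒜 0 : AddSubgroup B) : Set B) ∪ ↑t)).map (algebraMap B (Localization.Away h)) ≤
        Subring.closure (((locPiece 𝒜 hh 0 : AddSubgroup (Localization.Away h)) : Set (Localization.Away h)) ∪
          ↑(t.image (algebraMap B (Localization.Away h)))) := by
      rw [RingHom.map_closure, Subring.closure_le]
      rintro _ ⟨z, hz | hz, rfl⟩
      · exact Subring.subset_closure (Or.inl (algebraMap_mem_locPiece 𝒜 hh hz))
      · exact Subring.subset_closure (Or.inr (Finset.mem_coe.mpr (Finset.mem_image_of_mem _ (Finset.mem_coe.mp hz))))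
    exact mul_mem (hmap ⟨x, hx, rfl⟩) (pow_mem hinv n)

end Sigma

/-! ## The degree-`0` part of `B[h⁻¹]` is `B₀[h⁻¹]` -/

section ZeroEquiv

variable {ι : Type v} [AddCommGroup ι] [DecidableEq ι] {B : Type u} [CommRing B] (𝒜 : ι → AddSubgroup B) [GradedRing 𝒜]
  {A : Type u} [CommRing A] (e : A ≃+* ↥(𝒜 0)) (a : A)

/-- The structure map `A → B[h⁻¹]`, `h = e a`. -/
def toAwayB : A →+* Localization.Away ((e a : ↥(𝒜 0)) : B) :=
  (algebraMap B _).comp ((SetLike.GradeZero.subring 𝒜).subtype.comp (e : A →+* ↥(𝒜 0)))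

/-- Unfolding `toAwayB`. -/
theorem toAwayB_apply (x : A) : toAwayB 𝒜 e a x = algebraMap B _ ((e x : ↥(𝒜 0)) : B) := rfl

/-- `a` becomes a unit in `B[h⁻¹]`. -/
theorem isUnit_toAwayB : IsUnit (toAwayB 𝒜 e a a) := by
  rw [toAwayB_apply]; exact IsLocalization.Away.algebraMap_isUnit _

/-- The map `A[a⁻¹] → B[h⁻¹]`, `h = e a`. -/
def awayLift : Localization.Away a →+* Localization.Away ((e a : ↥(𝒜 0)) : B) :=
  IsLocalization.Away.lift a (isUnit_toAwayB 𝒜 e a)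

/-- Pin: `x/1 ↦ e x/1`. -/
theorem awayLift_algebraMap (x : A) : awayLift 𝒜 e a (algebraMap A _ x) = algebraMap B _ ((e x : ↥(𝒜 0)) : B) := by
  rw [← toAwayB_apply]; exact IsLocalization.Away.lift_eq a (isUnit_toAwayB 𝒜 e a) x

/-- Pin: `a⁻¹ ↦ h⁻¹`. -/
theorem awayLift_invSelf : awayLift 𝒜 e a (IsLocalization.Away.invSelf a) = IsLocalization.Away.invSelf ((e a : ↥(𝒜 0)) : B) := by
  have ha : awayLift 𝒜 e a (algebraMap A _ a) * awayLift 𝒜 e a (IsLocalization.Away.invSelf a) = 1 := by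
    rw [← map_mul, IsLocalization.Away.mul_invSelf, map_one]
  rw [awayLift_algebraMap] at ha
  have hb : algebraMap B (Localization.Away ((e a : ↥(𝒜 0)) : B)) ((e a : ↥(𝒜 0)) : B) *
      IsLocalization.Away.invSelf ((e a : ↥(𝒜 0)) : B) = 1 := IsLocalization.Away.mul_invSelf _
  exact (IsLocalization.Away.algebraMap_isUnit ((e a : ↥(𝒜 0)) : B)).mul_left_cancel (ha.trans hb.symm)

/-- Pin: `x / aⁿ ↦ e x / hⁿ`. -/
theorem awayLift_mk (x : A) (n : ℕ) :
    awayLift 𝒜 e a (algebraMap A _ x * IsLocalization.Away.invSelf a ^ n) =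
      algebraMap B _ ((e x : ↥(𝒜 0)) : B) * IsLocalization.Away.invSelf ((e a : ↥(𝒜 0)) : B) ^ n := by
  rw [map_mul, map_pow, awayLift_algebraMap, awayLift_invSelf]

/-- The image of `A[a⁻¹]` lies in degree `0`. -/
theorem awayLift_mem (y : Localization.Away a) : awayLift 𝒜 e a y ∈ locPiece 𝒜 (e a).2 0 := by
  obtain ⟨x, n, rfl⟩ := exists_eq_algebraMap_mul_invSelf_pow (h := a) y
  rw [awayLift_mk]
  exact mk_mem_locPiece_of_deg_zero 𝒜 (e a).2 n (e x).2

/-- `A[a⁻¹] → B[h⁻¹]` is injective. -/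
theorem awayLift_injective : Function.Injective (awayLift 𝒜 e a) := by
  rw [injective_iff_map_eq_zero]
  intro y hy
  obtain ⟨x, n, rfl⟩ := exists_eq_algebraMap_mul_invSelf_pow (h := a) y
  rw [awayLift_mk] at hy
  have hunit' : IsUnit (IsLocalization.Away.invSelf ((e a : ↥(𝒜 0)) : B) ^ n) :=
    (IsUnit.of_mul_eq_one_right _ (IsLocalization.Away.mul_invSelf (S := Localization.Away ((e a : ↥(𝒜 0)) : B))
      ((e a : ↥(𝒜 0)) : B))).pow n
  have h0 : algebraMap B (Localization.Away ((e a : ↥(𝒜 0)) : B)) ((e x : ↥(𝒜 0)) : B) = 0 := (hunit'.mul_left_eq_zero).mp hy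
  obtain ⟨⟨_, N, rfl⟩, hN⟩ := (IsLocalization.map_eq_zero_iff (Submonoid.powers ((e a : ↥(𝒜 0)) : B))
    (Localization.Away ((e a : ↥(𝒜 0)) : B)) _).mp h0
  have hA : a ^ N * x = 0 := by
    apply e.injective
    apply Subtype.ext
    rw [map_mul, map_pow, map_zero]
    exact hN
  have : algebraMap A (Localization.Away a) x = 0 :=
    (IsLocalization.map_eq_zero_iff (Submonoid.powers a) _ _).mpr ⟨⟨_, N, rfl⟩, hA⟩
  rw [this, zero_mul]

/-- **`A[a⁻¹] ≃+* (B[h⁻¹])₀`** for `e : A ≃+* B₀`, `h = e a`. [OURS · L1 W4.5c] -/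
def awayZeroEquiv : letI := locGradedRing 𝒜 (e a).2; Localization.Away a ≃+* ↥(locPiece 𝒜 (e a).2 0) :=
  letI := locGradedRing 𝒜 (e a).2
  RingEquiv.ofBijective ((awayLift 𝒜 e a).codRestrict (SetLike.GradeZero.subring (locPiece 𝒜 (e a).2)) (awayLift_mem 𝒜 e a))
    ⟨fun x y hxy => awayLift_injective 𝒜 e a (congrArg Subtype.val hxy), fun ⟨y, hy⟩ => by
      obtain ⟨n, x, hx, rfl⟩ := (mem_locPiece_zero_iff 𝒜 (e a).2).mp hy
      exact ⟨algebraMap A _ (e.symm ⟨x, hx⟩) * IsLocalization.Away.invSelf a ^ n, Subtype.ext (by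
        change awayLift 𝒜 e a _ = _
        rw [awayLift_mk, e.apply_symm_apply])⟩⟩

/-- The underlying element of `awayZeroEquiv y` is `awayLift y`. -/
theorem coe_awayZeroEquiv (y : Localization.Away a) :
    letI := locGradedRing 𝒜 (e a).2
    ((awayZeroEquiv 𝒜 e a y : ↥(locPiece 𝒜 (e a).2 0)) : Localization.Away ((e a : ↥(𝒜 0)) : B)) = awayLift 𝒜 e a y :=
  rfl

/-- Pin: `awayZeroEquiv (x / aⁿ) = e x / hⁿ`. -/
theorem coe_awayZeroEquiv_mk (x : A) (n : ℕ) :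
    letI := locGradedRing 𝒜 (e a).2
    ((awayZeroEquiv 𝒜 e a (algebraMap A _ x * IsLocalization.Away.invSelf a ^ n) : ↥(locPiece 𝒜 (e a).2 0)) :
        Localization.Away ((e a : ↥(𝒜 0)) : B)) =
      algebraMap B _ ((e x : ↥(𝒜 0)) : B) * IsLocalization.Away.invSelf ((e a : ↥(𝒜 0)) : B) ^ n :=
  awayLift_mk 𝒜 e a x n

/-- Pin: `awayZeroEquiv (x / 1) = e x / 1`. -/
theorem coe_awayZeroEquiv_algebraMap (x : A) :
    letI := locGradedRing 𝒜 (e a).2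
    ((awayZeroEquiv 𝒜 e a (algebraMap A _ x) : ↥(locPiece 𝒜 (e a).2 0)) : Localization.Away ((e a : ↥(𝒜 0)) : B)) =
      algebraMap B _ ((e x : ↥(𝒜 0)) : B) :=
  awayLift_algebraMap 𝒜 e a x

/-- **Intertwining transports to the localisation.** If `act : A →+* A` is intertwined with `σ` by `e` and fixes `a`, and
`act' : A[a⁻¹] →+* A[a⁻¹]` extends `act`, then `awayZeroEquiv ∘ act' = σ_h ∘ awayZeroEquiv` (on underlying elements of `B[h⁻¹]`).
[OURS · L1 W4.5c] -/
theorem coe_awayZeroEquiv_intertwine (σ : B ≃+* B) (act : A →+* A) (hσ : ∀ t : A, ((e (act t) : ↥(𝒜 0)) : B) = σ ((e t : ↥(𝒜 0)) : B))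
    (ha : act a = a) (act' : Localization.Away a →+* Localization.Away a)
    (hact' : ∀ t : A, act' (algebraMap A _ t) = algebraMap A _ (act t)) (y : Localization.Away a) :
    letI := locGradedRing 𝒜 (e a).2
    ((awayZeroEquiv 𝒜 e a (act' y) : ↥(locPiece 𝒜 (e a).2 0)) : Localization.Away ((e a : ↥(𝒜 0)) : B)) =
      sigmaAway σ (show σ ((e a : ↥(𝒜 0)) : B) = (e a : ↥(𝒜 0)) by rw [← hσ a, ha])
        ((awayZeroEquiv 𝒜 e a y : ↥(locPiece 𝒜 (e a).2 0)) : Localization.Away ((e a : ↥(𝒜 0)) : B)) := by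
  have hσa : σ ((e a : ↥(𝒜 0)) : B) = (e a : ↥(𝒜 0)) := by rw [← hσ a, ha]
  -- both sides are ring homs `A[a⁻¹] → B[h⁻¹]` agreeing on `A`
  suffices H : (awayLift 𝒜 e a).comp act' = ((sigmaAway σ hσa : _ ≃+* _) : _ →+* _).comp (awayLift 𝒜 e a) from
    RingHom.congr_fun H y
  refine IsLocalization.ringHom_ext (Submonoid.powers a) (RingHom.ext fun t => ?_)
  change awayLift 𝒜 e a (act' (algebraMap A _ t)) = sigmaAway σ hσa (awayLift 𝒜 e a (algebraMap A _ t))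
  rw [hact', awayLift_algebraMap, awayLift_algebraMap, sigmaAway_algebraMap, hσ]

end ZeroEquiv

end Summit.ResolutionOfSingularities.ResolutionOfSingularities.Theorems.WildQuotientResolution.S1.NodeAway

end
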